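/-
Copyright: statement-level skeleton of a published paper (lit-balaban cell, Phase-2 proof seat p39 gen 6). No proof claims
beyond what the kernel checks below.
-/
import Literature.MathematicalPhysics.QuantumFieldTheory.Balaban1983to89.B3Bound316ZeroTorus
import Literature.MathematicalPhysics.QuantumFieldTheory.Balaban1983to89.B3KernelConvolutionTorusSup

/-!
# B3 — T. Bałaban, *(Higgs)₂,₃ quantum fields in a finite volume. III. Renormalization*, CMP **88** (1983) 411–445
[Balaban1983Higgs3], p. 439 [PDF 29]: **"Rescaling from the η-lattice to the L^{−j″}-lattice and using the same method as in
(3.16) we get some convergent expressions plus q²g(x)g′(x)Σ_{x′}ξ^d(∂^ξ_μC^ξ)(x − x′)C^ξ(x − x′)"** — the CROSS TERMS of the first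
term of (3.23) under the replacement `G^ξ_{j″}(0) = C^ξ + M` PROVED BOUNDED, uniformly in the volume and in the scale, for the
zero-field torus MODEL INSTANCE `G^ξ_{j″}(0) = G^ξ_{j″} = G0xi` (the rescaled propagator `G_k(T_ε,0)` of Bałaban's scalar tower on
the printed `ξ = L^{−k}` lattice), `C^ξ = C^ξ_T` (`CxiT ξ`), `M := G^ξ_{j″}(0) − C^ξ_T` (`Mxi`); whence **"Hence the last graph in
(3.22) defines a vertex with some convergent function"** for this instance: the whole bracket of (3.23) is bounded by `C₁ + C₂K′`
(`g′` `K′`-Lipschitz), one pair of constants for all volumes and all scales `1 ≤ k = j″ ≤ K`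

statement-level skeleton of published theorems with citation tags; proofs where landed; nothing here is a claim about
the Yang–Mills mass gap

PDF held: `paper:balaban1983-higgs-2-3-quantum-fields-finite-volume` (journal page = PDF page + 410); p. 439 [PDF 29] read in
the OCR text (`p0029.txt`), p. 437 [PDF 27] (`p0027.txt`) for *"the same method as in (3.16)"*.  Rows **B3.Eq3.21-3.24** (and
B3.Eq3.11-3.17) of `HOME/lit-balaban-r15/ROWS-B3.md` (fold owner r15).  The bracket of (3.23) is r15's
`B3Sect3ScalarSelfEnergy.bracket323`; its second term is bounded under kernel hypotheses by this seat's gen 5 `B3Bound323`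
(`abs_bracket323_le_first_add`), the `C^ξ_T·C^ξ_T` member of the first term by gen 5 `B3Eq324Torus.abs_first324_CxiT_le`
(the (3.24) sum, bounded uniformly).  THIS FILE treats what p. 439 calls *"some convergent expressions"*: writing
`G^ξ_{j″}(0) = C^ξ_T + M` in the first term `Σ_{y′}ξ^d(∂^ξ_μG^ξ_{j″}(0))(y,y′)G^ξ_{j″}(y,y′)` (at zero field both propagators are
`G0xi`) gives `Σξ^d(∂C)C + Σξ^d(∂C)M + Σξ^d(∂M)G(0)` (`first323_G0xi_split`), and the two cross sums are bounded by constants.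
THE METHOD ("the same method as in (3.16)", kernel-checked): by the resolvent identity of (3.16)
(`B3Eq316ResolventZeroTorus.resolvent316_zeroTorus`) `M = ξ^dG(0)·D·C^ξ_T`, `D = (1 − (L^kε)²m²)1 − a_kP_k` (`Mxi_split`,
`d1Kernel_Mxi_split`); the factors obey, AT ALL SITES of the torus, `|G(0)|, |C^ξ_T| ≤ O(1)e^{−c|y−y′|}/max(1,|y−y′|)` and
`|∂G(0)|, |∂C^ξ_T| ≤ O(1)e^{−c|y−y′|}/max(1,|y−y′|)²` (`B3GkZeroTorusRescaled.G0xi_bounds`, `abs_CxiT_profile`,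
`B3Bound316ZeroTorus.abs_d1Kernel_CxiT_profile`); two `1/|·|`-kernels convolve to a BOUNDED kernel (the AM–GM estimate
`B3KernelConvolutionTorusSup.conv11_le` / `conv11_block_le`), so `sup|M| < ∞` (`abs_Mxi_le`) and `sup|Σ_{y′}ξ^dC^ξ_T(z,y′)G(0)(y,y′)| < ∞`
(`abs_sum_CxiT_mul_G0xi_le`); the differentiated factors are summable, `Σ_zξ^d|∂G(0)(y,z)|, Σ_zξ^d|∂C^ξ_T(y,z)| ≤ O(1)`
(`sum_abs_le_of_profile`), and `Σ_{z′}|P_k(z,z′)| = 1` (`sum_abs_Pk_row`).  Hence `|Σξ^d(∂C)M| ≤ ‖∂C‖₁·sup|M|` and, after exchanging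
the order of summation, `|Σξ^d(∂M)G(0)| ≤ (|1 − (L^kε)²m²| + a_k)·‖∂G(0)‖₁·sup|C∘G(0)|` — no pointwise bound on `∂M` is needed.
* §1 algebra of the replacement: `G0xi_eq_CxiT_add_Mxi`, `d1Kernel_G0xi_eq_add`, **`first323_G0xi_split`**, `Dmid_sandwich`,
  `d1Kernel_Mxi`, `Mxi_split`, `d1Kernel_Mxi_split`, `sum_abs_Pk_row`, `abs_CxiT_profile`, `sum_abs_le_of_profile`.
* §2 the sup bounds **`abs_Mxi_le`** (`|M(y,y′)| ≤ Msup(δ,C,a,m²)` for all `y,y′`, every volume and scale) and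
  **`abs_sum_CxiT_mul_G0xi_le`**.
* §3 **`first323_G0xi_zero_torus`**: `∃ C₁` with `|Σ_{y′}ξ^d(∂^ξ_μG^ξ_{j″}(0))(y,y′)G^ξ_{j″}(y,y′)| ≤ C₁` for every volume
  `P = (3,L,m,K)`, every `1 ≤ k ≤ K`, `μ`, `y` — the first term of (3.23) is *"convergent"* (bounded uniformly) at the instance;
  **`bracket323_G0xi_zero_torus`**: `∃ C₁ C₂` with `|[(3.23)](y)| ≤ C₁ + C₂K′` for all volumes, scales, `μ`, `y`, `|g|,|g′| ≤ 1` and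
  `g′` `K′`-Lipschitz (`|g′(y′) − g′(y)| ≤ K′ξ|y − y′|₁`, the reading of gen 5 `B3Bound323`) — p. 439 *"the last graph in (3.22)
  defines a vertex with some convergent function"* for the instance, with NO kernel hypothesis left; v1.1 rider
  **`expr323_G0xi_zero_torus`**: the same at the level of r15's whole expression `expr323` —
  `|(3.23)| ≤ (C₁ + C₂K′)·Σ_μΣ_x ξ³‖φ(x)‖‖q²(∂^ξ_μφ′)(x)‖` (a vertex with a bounded coefficient).
HONEST SCOPE: `d = 3`; `A = B̃ = 0`, `U ≡ 1`, `Ω` = the whole torus (scope of the zero-field torus propagator); both propagators of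
(3.23) are the SAME rescaled `G_k(T_ε,0)` (at zero field `G_{j″}(0) = G_{j″}`); fixed `a > 0`, `m² ≥ 0`; constants existential
(boundedness, not the existence of a `ξ → 0` limit); the sup torus distance.  NOT claimed: external fields (rows B3.Eq2.10–2.12 at
the print's generality), `d = 2`, numerical values, the limit statement of (3.24).  Mathlib + the cited tree files only; theorems
only, no new definitions, no named facts; standard axioms.  Unit `lit-balaban-p39-g6` (Phase-2 proof seat p39, gen 6), HOME
`run/shared/lean/pub/lit-balaban/`, 2026-08-21.
-/

open scoped BigOperators

namespace Literature.MathematicalPhysics.QuantumFieldTheory.Balaban1983to89.B3Eq323CrossTermsZeroTorus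

open Matrix Finset B1RG242Torus B3GkZeroTorusRescaled B3Eq316ResolventZeroTorus B3KernelConvolutionTorus
open B3KernelConvolutionTorusSup B3Bound316ZeroTorus
open LatticeFieldCalculus B3Sect3ScalarSelfEnergy B3TorusRadialSums B3Bound316 B3CxiTorusBound
open B3CxiTorusDerivativeBound B3Eq324Torus B3Bound323

noncomputable section

variable {P : Params}

/-! ## §1 The replacement `G^ξ_{j″}(0) = C^ξ + M` inside the first term of (3.23) -/

/-- `G^ξ_{j″}(0) = C^ξ_T + M` entrywise (the definition of `M`). [cite: Balaban1983Higgs3, (3.16) p.437] -/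
theorem G0xi_eq_CxiT_add_Mxi (a msq : ℝ) (k : ℕ) (y y' : Site P 0) :
    G0xi P a msq k y y' = CxiT (P.eta k) y y' + Mxi P a msq k y y' := by
  simp only [Mxi]; ring

/-- `∂^ξ_μG^ξ_{j″}(0) = ∂^ξ_μC^ξ_T + ∂^ξ_μM` entrywise (linearity of the forward difference quotient).
[cite: Balaban1983Higgs3, (3.16) p.437] -/
theorem d1Kernel_G0xi_eq_add (a msq c : ℝ) (k : ℕ) (μ : Fin P.d) (y y' : Site P 0) :
    d1Kernel c μ (G0xi P a msq k) y y' = d1Kernel c μ (CxiT (P.eta k)) y y' + d1Kernel c μ (Mxi P a msq k) y y' := by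
  simp only [d1Kernel, Mxi]; ring

/-- **The replacement inside the first term of (3.23)** at the zero-field torus instance (`G^ξ_{j″}(0) = G^ξ_{j″} = G0xi`):
`Σ_{y′}ξ^d(∂^ξ_μG(0))(y,y′)G(0)(y,y′) = Σ_{y′}ξ^d(∂^ξ_μC^ξ_T)C^ξ_T + Σ_{y′}ξ^d(∂^ξ_μC^ξ_T)M + Σ_{y′}ξ^d(∂^ξ_μM)G(0)` — the printed
`C^ξC^ξ` term "plus" the cross terms. [cite: Balaban1983Higgs3, (3.23) p.439] -/
theorem first323_G0xi_split (a msq : ℝ) (k : ℕ) (μ : Fin P.d) (y : Site P 0) :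
    ∑ y' : Site P 0, P.eta k ^ P.d * (d1Kernel (P.eta k)⁻¹ μ (G0xi P a msq k) y y' * G0xi P a msq k y y') =
      ∑ y' : Site P 0, P.eta k ^ P.d * (d1Kernel (P.eta k)⁻¹ μ (CxiT (P.eta k)) y y' * CxiT (P.eta k) y y') +
        ∑ y' : Site P 0, P.eta k ^ P.d * (d1Kernel (P.eta k)⁻¹ μ (CxiT (P.eta k)) y y' * Mxi P a msq k y y') +
        ∑ y' : Site P 0, P.eta k ^ P.d *
          (d1Kernel (P.eta k)⁻¹ μ (Mxi P a msq k) y y' * G0xi P a msq k y y') := by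
  rw [← Finset.sum_add_distrib, ← Finset.sum_add_distrib]
  refine Finset.sum_congr rfl fun y' _ => ?_
  rw [d1Kernel_G0xi_eq_add, G0xi_eq_CxiT_add_Mxi (P := P) a msq k y y']
  ring

/-- The middle operator sandwiched: `Σ_{z′}(Σ_z f(z)D(z,z′))g(z′) = (1 − (L^kε)²m²)Σ_z f(z)g(z) − a_kΣ_{z,z′}f(z)P_k(z,z′)g(z′)`,
`D = (1 − m²_{j″})1 − a_{j″}P_{j″}`. [cite: Balaban1983Higgs3, (3.16) p.437] -/
theorem Dmid_sandwich (a msq : ℝ) (k : ℕ) (f g : Site P 0 → ℝ) :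
    ∑ z' : Site P 0, (∑ z : Site P 0, f z * Dmid P a msq k z z') * g z' =
      (1 - P.spacing k ^ 2 * msq) * ∑ z : Site P 0, f z * g z -
        B1.aSeq a P.L k * ∑ z : Site P 0, ∑ z' : Site P 0, f z * (Qks P k * Qk P k) z z' * g z' := by
  classical
  set c₁ : ℝ := 1 - P.spacing k ^ 2 * msq with hc₁
  set c₂ : ℝ := B1.aSeq a P.L k with hc₂
  set Pk : Site P 0 → Site P 0 → ℝ := fun z z' => (Qks P k * Qk P k) z z' with hPk
  have hDz : ∀ z z' : Site P 0, Dmid P a msq k z z' = c₁ * (if z = z' then 1 else 0) - c₂ * Pk z z' :=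
    fun z z' => Dmid_apply P a msq k z z'
  show ∑ z', (∑ z, f z * Dmid P a msq k z z') * g z' = c₁ * ∑ z, f z * g z - c₂ * ∑ z, ∑ z', f z * Pk z z' * g z'
  simp_rw [hDz, mul_sub, Finset.sum_sub_distrib, sub_mul, Finset.sum_sub_distrib]
  congr 1
  · have hin : ∀ z' : Site P 0, ∑ z, f z * (c₁ * if z = z' then (1 : ℝ) else 0) = c₁ * f z' := by
      intro z'
      simp_rw [mul_ite, mul_one, mul_zero]
      rw [Finset.sum_ite_eq', if_pos (Finset.mem_univ _), mul_comm]
    simp_rw [hin]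
    rw [Finset.mul_sum]
    exact Finset.sum_congr rfl fun z' _ => by ring
  · calc ∑ z', (∑ z, f z * (c₂ * Pk z z')) * g z'
        = ∑ z', ∑ z, c₂ * (f z * Pk z z' * g z') := by
          refine Finset.sum_congr rfl fun z' _ => ?_
          rw [Finset.sum_mul]
          exact Finset.sum_congr rfl fun z _ => by ring
      _ = ∑ z, ∑ z', c₂ * (f z * Pk z z' * g z') := Finset.sum_comm
      _ = c₂ * ∑ z, ∑ z', f z * Pk z z' * g z' := by simp_rw [Finset.mul_sum]

/-- `M = ξ^d[(1 − (L^kε)²m²)·G(0)C^ξ_T − a_k·G(0)P_kC^ξ_T]` entrywise (the resolvent identity of (3.16) with `D` expanded).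
[cite: Balaban1983Higgs3, (3.16) p.437] -/
theorem Mxi_split {a msq : ℝ} (ha : 0 < a) (hm : 0 ≤ msq) {k : ℕ} (hk : 1 ≤ k) (y y' : Site P 0) :
    Mxi P a msq k y y' = P.eta k ^ P.d *
      ((1 - P.spacing k ^ 2 * msq) * ∑ z : Site P 0, G0xi P a msq k y z * CxiT (P.eta k) z y' -
        B1.aSeq a P.L k * ∑ z : Site P 0, ∑ z' : Site P 0,
          G0xi P a msq k y z * (Qks P k * Qk P k) z z' * CxiT (P.eta k) z' y') := by
  rw [Mxi_apply ha hm hk]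
  congr 1
  exact Dmid_sandwich (P := P) a msq k (fun z => G0xi P a msq k y z) (fun z' => CxiT (P.eta k) z' y')

/-- The LEFT derivative kernel of `M`: `(∂^ξ_νM)(y,y′) = ξ^dΣ_{z′}(Σ_z(∂^ξ_νG(0))(y,z)D(z,z′))C^ξ_T(z′,y′)`.
[cite: Balaban1983Higgs3, (3.16) p.437] -/
theorem d1Kernel_Mxi {a msq : ℝ} (ha : 0 < a) (hm : 0 ≤ msq) {k : ℕ} (hk : 1 ≤ k) (ν : Fin P.d) (y y' : Site P 0) :
    d1Kernel (P.eta k)⁻¹ ν (Mxi P a msq k) y y' = P.eta k ^ P.d *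
      ∑ z' : Site P 0, (∑ z : Site P 0, d1Kernel (P.eta k)⁻¹ ν (G0xi P a msq k) y z * Dmid P a msq k z z') *
        CxiT (P.eta k) z' y' := by
  rw [d1Kernel_eq_deriv_mul, resolvent316_zeroTorus ha hm hk, Matrix.mul_smul, Matrix.smul_apply, smul_eq_mul]
  congr 1
  rw [← Matrix.mul_assoc, ← Matrix.mul_assoc, Matrix.mul_apply]
  refine Finset.sum_congr rfl fun z' _ => ?_
  rw [Matrix.of_apply, Matrix.mul_apply]
  congr 1
  refine Finset.sum_congr rfl fun z _ => ?_
  rw [d1Kernel_eq_deriv_mul]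

/-- `∂^ξ_νM = ξ^d[(1 − (L^kε)²m²)·(∂G(0))C^ξ_T − a_k·(∂G(0))P_kC^ξ_T]` entrywise. [cite: Balaban1983Higgs3, (3.16) p.437] -/
theorem d1Kernel_Mxi_split {a msq : ℝ} (ha : 0 < a) (hm : 0 ≤ msq) {k : ℕ} (hk : 1 ≤ k) (ν : Fin P.d) (y y' : Site P 0) :
    d1Kernel (P.eta k)⁻¹ ν (Mxi P a msq k) y y' = P.eta k ^ P.d *
      ((1 - P.spacing k ^ 2 * msq) *
          ∑ z : Site P 0, d1Kernel (P.eta k)⁻¹ ν (G0xi P a msq k) y z * CxiT (P.eta k) z y' -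
        B1.aSeq a P.L k * ∑ z : Site P 0, ∑ z' : Site P 0,
          d1Kernel (P.eta k)⁻¹ ν (G0xi P a msq k) y z * (Qks P k * Qk P k) z z' * CxiT (P.eta k) z' y') := by
  rw [d1Kernel_Mxi ha hm hk]
  congr 1
  exact Dmid_sandwich (P := P) a msq k (fun z => d1Kernel (P.eta k)⁻¹ ν (G0xi P a msq k) y z)
    (fun z' => CxiT (P.eta k) z' y')

/-- The rows of `P_k = Q_k^*Q_k` on the `ξ`-lattice have `ℓ¹`-norm one: `Σ_{z′}|P_k(z,z′)| = ξ^d·|B^k| = 1` (`k ≤ m + K`).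
[cite: Balaban1982Higgs1, (2.11) p.609] -/
theorem sum_abs_Pk_row {k : ℕ} (hk : k ≤ P.m + P.K) (z : Site P 0) :
    ∑ z' : Site P 0, |(Qks P k * Qk P k) z z'| = 1 := by
  classical
  have h : ∀ z' : Site P 0, |(Qks P k * Qk P k) z z'| =
      if Site.proj k k z' = Site.proj k k z then P.eta k ^ P.d else 0 := by
    intro z'
    rw [Pk_apply hk]
    split_ifs
    · exact abs_of_nonneg (pow_nonneg (eta_pos P k).le _)
    · exact abs_zero
  simp_rw [h]
  rw [Finset.sum_ite, Finset.sum_const_zero, add_zero, Finset.sum_const, nsmul_eq_mul]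
  have hc : (Finset.univ.filter fun x : Site P 0 => Site.proj k k x = Site.proj k k z).card = (P.L ^ k) ^ P.d := by
    convert card_Bj hk (Site.proj k k z) using 2
  rw [hc, eta_eq_inv_pow, inv_pow]
  push_cast
  exact mul_inv_cancel₀ (pow_ne_zero _ (pow_ne_zero _ P.cast_L_pos.ne'))

/-- **`|C^ξ_T(y,z)| ≤ (torusConst + 472501)·e^{−½ξ|y−z|}/(ξ·max(1,|y−z|))` AT ALL SITES** (`d = 3`, `0 < ξ ≤ 1`, `ξN ≥ 1`): off the
diagonal p03's `abs_CxiT_le`, on it gen 5's `CxiT_diag_le` (`0 ≤ C^ξ_T(y,y) ≤ 472501ξ^{−1}`). [cite: Balaban1983Higgs3, (3.16) p.437] -/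
theorem abs_CxiT_profile {j : ℕ} (hd : P.d = 3) {ξ : ℝ} (hξ : 0 < ξ) (hξ1 : ξ ≤ 1) (hN : 1 ≤ ξ * (P.sitesPerDir j : ℝ))
    (y z : Site P j) :
    |CxiT ξ y z| ≤ (torusConst + 472501) *
      ((ξ * max (1 : ℝ) (supDist y z : ℝ))⁻¹ * Real.exp (-(1 / 2 * (ξ * (supDist y z : ℝ))))) := by
  have hT := torusConst_nonneg
  by_cases hne : z = y
  · subst hne
    rw [abs_of_nonneg (CxiT_nonneg hξ z z), max_one_supDist_self, (supDist_eq_zero_iff z z).mpr rfl, Nat.cast_zero,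
      mul_zero, mul_zero, neg_zero, Real.exp_zero, mul_one, mul_one]
    have h := CxiT_diag_le hd hξ hξ1 hN z
    have h0 : 0 ≤ ξ⁻¹ := inv_nonneg.mpr hξ.le
    nlinarith
  · have h := abs_CxiT_le hd hξ hξ1 hN hne
    rw [max_one_supDist_of_ne hne]
    refine h.trans ?_
    have h0 : 0 ≤ (ξ * (supDist y z : ℝ))⁻¹ * Real.exp (-(1 / 2 * (ξ * (supDist y z : ℝ)))) := by positivity
    rw [mul_assoc]
    nlinarith

/-- The `ℓ¹`-norm of a kernel with the derivative profile: if `|A(y,z)| ≤ c(ξ·max(1,|y−z|))^{−2}e^{−αξ|y−z|}` for all `z`, then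
`Σ_zξ³|A(y,z)| ≤ c(1 + radialConst 3 α 1 0)` (`d = 3`, `0 < ξ ≤ 1`; `B3KernelConvolutionTorus.sum_const_mul_profile_le` at `ξ ≤ 1`).
[cite: Balaban1983Higgs3, (3.16) p.437] -/
theorem sum_abs_le_of_profile {j : ℕ} (hd : P.d = 3) {ξ : ℝ} (hξ : 0 < ξ) (hξ1 : ξ ≤ 1) {α c : ℝ} (hα : 0 < α)
    (hc : 0 ≤ c) (A : Kernel P j) (y : Site P j)
    (hA : ∀ z : Site P j, |A y z| ≤ c * (((ξ * max (1 : ℝ) (supDist y z : ℝ)) ^ 2)⁻¹ *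
      Real.exp (-(α * (ξ * (supDist y z : ℝ)))))) :
    ∑ z : Site P j, ξ ^ P.d * |A y z| ≤ c * (1 + radialConst 3 α 1 0) := by
  calc ∑ z : Site P j, ξ ^ P.d * |A y z|
      ≤ ∑ z : Site P j, ξ ^ P.d * (c * (((ξ * max (1 : ℝ) (supDist y z : ℝ)) ^ 2)⁻¹ *
          Real.exp (-(α * (ξ * (supDist y z : ℝ)))))) :=
        Finset.sum_le_sum fun z _ => mul_le_mul_of_nonneg_left (hA z) (pow_nonneg hξ.le _)
    _ ≤ c * (1 + radialConst P.d α ξ 0) := sum_const_mul_profile_le hd hξ hξ1 hα hc y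
    _ ≤ c * (1 + radialConst 3 α 1 0) := by
        rw [hd]
        have h := radialConst_mono 3 hα hξ1 0
        gcongr

/-! ## §2 "the same method as in (3.16)": the sup bounds on `M` and on `C^ξ_T∘G(0)` -/

/-- **`sup|M| < ∞`, uniformly**: for `d = 3`, `1 ≤ k ≤ K` and the value profile `|G(0)(y,z)| ≤ C·e^{−δξ|y−z|}/(ξ·max(1,|y−z|))` at
all sites, every entry of `M = ξ^dG(0)DC^ξ_T` satisfies `|M(y,y′)| ≤ (1 + m²)·[C(torusConst + 472501)/2·(2 + R_{δ/2} + R_{1/4})] +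
a·[C(torusConst + 472501)/2·((1 + R_{δ/2})(1 + R′_{1/4}) + (1 + R′_{δ/2})(1 + R_{1/4}))]` (`R_c = radialConst 3 c 1 0`,
`R′_c = radialConst 3 c 1 2`) — two `1/|·|` kernels convolve to a bounded kernel (`conv11_le`, `conv11_block_le`), `|1 − (L^kε)²m²| ≤ 1 + m²`,
`0 ≤ a_k ≤ a`. [cite: Balaban1983Higgs3, (3.16) p.437] -/
theorem abs_Mxi_le {a msq : ℝ} {k : ℕ} {δ C : ℝ} (hPd : P.d = 3) (ha : 0 < a) (hmsq : 0 ≤ msq) (hk1 : 1 ≤ k)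
    (hkK : k ≤ P.K) (hδ : 0 < δ) (hC : 0 ≤ C)
    (hGv : ∀ y z : Site P 0, |G0xi P a msq k y z| ≤
      C * ((P.eta k * max (1 : ℝ) (supDist y z : ℝ))⁻¹ * Real.exp (-(δ * (P.eta k * (supDist y z : ℝ))))))
    (y y' : Site P 0) :
    |Mxi P a msq k y y'| ≤
      (1 + msq) * (C * (torusConst + 472501) / 2 *
          (2 + radialConst 3 (δ / 2) 1 0 + radialConst 3 (1 / 2 / 2) 1 0)) +
        a * (C * (torusConst + 472501) / 2 *
          ((1 + radialConst 3 (δ / 2) 1 0) * (1 + radialConst 3 (1 / 2 / 2) 1 2) +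
            (1 + radialConst 3 (δ / 2) 1 2) * (1 + radialConst 3 (1 / 2 / 2) 1 0))) := by
  have hkm : k ≤ P.m + P.K := hkK.trans (Nat.le_add_left _ _)
  have hη : 0 < P.eta k := eta_pos P k
  have hη1 : P.eta k ≤ 1 := eta_le_one P k
  have hηd : 0 < P.eta k ^ P.d := pow_pos hη _
  have hN : 1 ≤ P.eta k * (P.sitesPerDir 0 : ℝ) := one_le_eta_mul_sitesPerDir P hkm
  have hs1 : P.spacing k ≤ 1 := spacing_le_one P hkK
  have hs0 : 0 < P.spacing k := P.spacing_pos k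
  have hL1 : (1 : ℝ) < (P.L : ℝ) := one_lt_cast_L P
  have hT := torusConst_nonneg
  have hcT0 : 0 ≤ torusConst + 472501 := by linarith
  -- the radial constants (at ξ and at 1)
  have hq : (0 : ℝ) < 1 / 2 / 2 := by norm_num
  have hRm : ∀ {c : ℝ}, 0 < c → ∀ p : ℕ, radialConst P.d c (P.eta k) p ≤ radialConst 3 c 1 p := by
    intro c hc p; rw [hPd]; exact radialConst_mono 3 hc hη1 p
  have hx₁ := radialConst_nonneg P.d (half_pos hδ) hη.le 0
  have hx₂ := radialConst_nonneg P.d hq hη.le 0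
  have hx₃ := radialConst_nonneg P.d (half_pos hδ) hη.le 2
  have hx₄ := radialConst_nonneg P.d hq hη.le 2
  have hR₁ := radialConst_nonneg 3 (half_pos hδ) zero_le_one 0
  have hR₂ := radialConst_nonneg 3 hq zero_le_one 0
  have hR₃ := radialConst_nonneg 3 (half_pos hδ) zero_le_one 2
  have hR₄ := radialConst_nonneg 3 hq zero_le_one 2
  set S₁ : ℝ := C * (torusConst + 472501) / 2 *
    (2 + radialConst 3 (δ / 2) 1 0 + radialConst 3 (1 / 2 / 2) 1 0) with hS₁
  set S₂ : ℝ := C * (torusConst + 472501) / 2 *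
    ((1 + radialConst 3 (δ / 2) 1 0) * (1 + radialConst 3 (1 / 2 / 2) 1 2) +
      (1 + radialConst 3 (δ / 2) 1 2) * (1 + radialConst 3 (1 / 2 / 2) 1 0)) with hS₂
  -- the factor profiles and the block kernel
  have hB : ∀ z w : Site P 0, |CxiT (P.eta k) z w| ≤ (torusConst + 472501) *
      ((P.eta k * max (1 : ℝ) (supDist z w : ℝ))⁻¹ * Real.exp (-(1 / 2 * (P.eta k * (supDist z w : ℝ))))) :=
    fun z w => abs_CxiT_profile hPd hη hη1 hN z w
  have hE : ∀ z z' : Site P 0, |(Qks P k * Qk P k) z z'| ≤ 1 * P.eta k ^ P.d := fun z z' => by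
    rw [one_mul]; exact Pk_abs_le hkm z z'
  have hEs : ∀ z z' : Site P 0, (Qks P k * Qk P k) z z' ≠ 0 → P.eta k * (supDist z z' : ℝ) ≤ 2 :=
    fun z z' h => eta_supDist_le_two_of_Pk_ne_zero hkm h
  -- the two convolution sup bounds (decay rate γ = 0)
  have hI := conv11_le hPd hη hη1 hδ one_half_pos le_rfl (by linarith) (by norm_num) hC hcT0
    (G0xi P a msq k) (CxiT (P.eta k)) hGv hB y y'
  have hII := conv11_block_le hPd hη hη1 hδ one_half_pos le_rfl (by linarith) (by norm_num) hC hcT0 zero_le_one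
    (G0xi P a msq k) (fun z z' => (Qks P k * Qk P k) z z') (CxiT (P.eta k)) hGv hB hE hEs y y'
  simp only [zero_mul, mul_zero, neg_zero, Real.exp_zero, mul_one, one_mul] at hI hII
  have hI' : ∑ z : Site P 0, P.eta k ^ P.d * (|G0xi P a msq k y z| * |CxiT (P.eta k) z y'|) ≤ S₁ := by
    refine hI.trans ?_
    rw [hS₁]
    have h1 := hRm (half_pos hδ) 0; have h2 := hRm hq 0
    gcongr
  have hII' : ∑ z : Site P 0, ∑ z' : Site P 0, P.eta k ^ P.d *
      (|G0xi P a msq k y z| * |(Qks P k * Qk P k) z z'| * |CxiT (P.eta k) z' y'|) ≤ S₂ := by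
    refine hII.trans ?_
    rw [hS₂]
    have h1 := hRm (half_pos hδ) 0; have h2 := hRm hq 0; have h3 := hRm (half_pos hδ) 2; have h4 := hRm hq 2
    gcongr
  -- the scalar factors of `D`
  have hc₁ : |1 - P.spacing k ^ 2 * msq| ≤ 1 + msq := by
    have hs2 : P.spacing k ^ 2 ≤ 1 := pow_le_one₀ hs0.le hs1
    have hsm : P.spacing k ^ 2 * msq ≤ msq := mul_le_of_le_one_left hmsq hs2
    have hsm0 : 0 ≤ P.spacing k ^ 2 * msq := mul_nonneg (pow_nonneg hs0.le 2) hmsq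
    rw [abs_le]; constructor <;> linarith
  have hc₂ : 0 ≤ B1.aSeq a P.L k := (B1.aSeq_pos ha hL1 hk1).le
  have hc₂' : B1.aSeq a P.L k ≤ a := B1.aSeq_le ha hL1 k hk1
  rw [Mxi_split ha hmsq hk1]
  have hT1 : |P.eta k ^ P.d * ((1 - P.spacing k ^ 2 * msq) *
      ∑ z : Site P 0, G0xi P a msq k y z * CxiT (P.eta k) z y')| ≤ (1 + msq) * S₁ := by
    rw [abs_mul, abs_of_pos hηd, abs_mul, mul_left_comm]
    refine mul_le_mul hc₁ ?_ (by positivity) (by positivity)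
    rw [← abs_of_pos hηd, ← abs_mul, Finset.mul_sum]
    refine (Finset.abs_sum_le_sum_abs _ _).trans (le_trans (Finset.sum_le_sum fun z _ => ?_) hI')
    rw [abs_mul, abs_mul, abs_of_pos hηd]
  have hT2 : |P.eta k ^ P.d * (B1.aSeq a P.L k * ∑ z : Site P 0, ∑ z' : Site P 0,
      G0xi P a msq k y z * (Qks P k * Qk P k) z z' * CxiT (P.eta k) z' y')| ≤ a * S₂ := by
    rw [abs_mul, abs_of_pos hηd, abs_mul, abs_of_nonneg hc₂, mul_left_comm]
    refine mul_le_mul hc₂' ?_ (by positivity) ha.le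
    rw [← abs_of_pos hηd, ← abs_mul, Finset.mul_sum]
    refine (Finset.abs_sum_le_sum_abs _ _).trans (le_trans (Finset.sum_le_sum fun z _ => ?_) hII')
    rw [Finset.mul_sum]
    refine (Finset.abs_sum_le_sum_abs _ _).trans (Finset.sum_le_sum fun z' _ => ?_)
    rw [abs_mul, abs_mul, abs_mul, abs_of_pos hηd]
  rw [mul_sub]
  exact (abs_sub _ _).trans (add_le_add hT1 hT2)

/-- **`sup|C^ξ_T∘G(0)| < ∞`, uniformly**: with the value profile of `G(0)` at all sites (constant `C`, rate `δ`), for all `z, y`: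
`|Σ_{y′}ξ^dC^ξ_T(z,y′)G(0)(y,y′)| ≤ (torusConst + 472501)C/2·(2 + radialConst 3 ¼ 1 0 + radialConst 3 (δ/2) 1 0)` (`conv11_le`).
[cite: Balaban1983Higgs3, (3.16) p.437] -/
theorem abs_sum_CxiT_mul_G0xi_le {a msq : ℝ} {k : ℕ} {δ C : ℝ} (hPd : P.d = 3) (hkK : k ≤ P.K) (hδ : 0 < δ) (hC : 0 ≤ C)
    (hGv : ∀ y z : Site P 0, |G0xi P a msq k y z| ≤
      C * ((P.eta k * max (1 : ℝ) (supDist y z : ℝ))⁻¹ * Real.exp (-(δ * (P.eta k * (supDist y z : ℝ))))))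
    (z y : Site P 0) :
    |∑ y' : Site P 0, P.eta k ^ P.d * (CxiT (P.eta k) z y' * G0xi P a msq k y y')| ≤
      (torusConst + 472501) * C / 2 * (2 + radialConst 3 (1 / 2 / 2) 1 0 + radialConst 3 (δ / 2) 1 0) := by
  have hkm : k ≤ P.m + P.K := hkK.trans (Nat.le_add_left _ _)
  have hη : 0 < P.eta k := eta_pos P k
  have hη1 : P.eta k ≤ 1 := eta_le_one P k
  have hηd : 0 < P.eta k ^ P.d := pow_pos hη _
  have hN : 1 ≤ P.eta k * (P.sitesPerDir 0 : ℝ) := one_le_eta_mul_sitesPerDir P hkm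
  have hT := torusConst_nonneg
  have hcT0 : 0 ≤ torusConst + 472501 := by linarith
  have hq : (0 : ℝ) < 1 / 2 / 2 := by norm_num
  have hB : ∀ z w : Site P 0, |CxiT (P.eta k) z w| ≤ (torusConst + 472501) *
      ((P.eta k * max (1 : ℝ) (supDist z w : ℝ))⁻¹ * Real.exp (-(1 / 2 * (P.eta k * (supDist z w : ℝ))))) :=
    fun z w => abs_CxiT_profile hPd hη hη1 hN z w
  have hGt : ∀ m w : Site P 0, |(fun m w : Site P 0 => G0xi P a msq k w m) m w| ≤
      C * ((P.eta k * max (1 : ℝ) (supDist m w : ℝ))⁻¹ * Real.exp (-(δ * (P.eta k * (supDist m w : ℝ))))) := by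
    intro m w
    have h := hGv w m
    simp only [supDist_comm w m] at h
    exact h
  have h := conv11_le hPd hη hη1 one_half_pos hδ le_rfl (by norm_num) (by linarith) hcT0 hC
    (CxiT (P.eta k)) (fun m w : Site P 0 => G0xi P a msq k w m) hB hGt z y
  simp only [zero_mul, neg_zero, Real.exp_zero, mul_one] at h
  have h1 := radialConst_mono 3 hq hη1 0
  have h2 := radialConst_mono 3 (half_pos hδ) hη1 0
  have hx₁ := radialConst_nonneg 3 (half_pos hδ) hη.le 0
  have hx₂ := radialConst_nonneg 3 hq hη.le 0
  calc |∑ y' : Site P 0, P.eta k ^ P.d * (CxiT (P.eta k) z y' * G0xi P a msq k y y')|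
      ≤ ∑ y' : Site P 0, |P.eta k ^ P.d * (CxiT (P.eta k) z y' * G0xi P a msq k y y')| := Finset.abs_sum_le_sum_abs _ _
    _ = ∑ y' : Site P 0, P.eta k ^ P.d * (|CxiT (P.eta k) z y'| * |G0xi P a msq k y y'|) :=
        Finset.sum_congr rfl fun y' _ => by rw [abs_mul, abs_mul, abs_of_pos hηd]
    _ ≤ (torusConst + 472501) * C / 2 *
          (2 + radialConst P.d (1 / 2 / 2) (P.eta k) 0 + radialConst P.d (δ / 2) (P.eta k) 0) := h
    _ ≤ (torusConst + 472501) * C / 2 * (2 + radialConst 3 (1 / 2 / 2) 1 0 + radialConst 3 (δ / 2) 1 0) := by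
        rw [hPd]; gcongr

/-! ## §3 The cross terms are bounded: the first term of (3.23), and the whole bracket, at the instance -/

/-- kernel: a weighted sum against a uniformly bounded factor. [cite: Balaban1983Higgs3, (3.23) p.439] -/
private theorem abs_sum_mul_le {ι : Type*} [Fintype ι] {w F S : ℝ} (hw : 0 ≤ w) (hS : 0 ≤ S) (f g : ι → ℝ)
    (hf : ∑ z, w * |f z| ≤ F) (hg : ∀ z, |g z| ≤ S) : |∑ z, w * (f z * g z)| ≤ F * S := by
  calc |∑ z, w * (f z * g z)| ≤ ∑ z, |w * (f z * g z)| := Finset.abs_sum_le_sum_abs _ _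
    _ ≤ ∑ z, w * |f z| * S := Finset.sum_le_sum fun z _ => by
        rw [abs_mul, abs_mul, abs_of_nonneg hw, ← mul_assoc]
        exact mul_le_mul_of_nonneg_left (hg z) (mul_nonneg hw (abs_nonneg _))
    _ = (∑ z, w * |f z|) * S := by rw [Finset.sum_mul]
    _ ≤ F * S := mul_le_mul_of_nonneg_right hf hS

/-- kernel: exchanging the order of summation (single middle sum). [cite: Balaban1983Higgs3, (3.23) p.439] -/
private theorem swap_single {ι : Type*} [Fintype ι] (w : ℝ) (f G : ι → ℝ) (K : ι → ι → ℝ) :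
    ∑ y', w * ((w * ∑ z, f z * K z y') * G y') = ∑ z, w * f z * ∑ y', w * (K z y' * G y') := by
  calc ∑ y', w * ((w * ∑ z, f z * K z y') * G y') = ∑ y', ∑ z, w * f z * (w * (K z y' * G y')) := by
        refine Finset.sum_congr rfl fun y' _ => ?_
        rw [Finset.mul_sum, Finset.sum_mul, Finset.mul_sum]
        exact Finset.sum_congr rfl fun z _ => by ring
    _ = ∑ z, ∑ y', w * f z * (w * (K z y' * G y')) := Finset.sum_comm
    _ = ∑ z, w * f z * ∑ y', w * (K z y' * G y') :=
        Finset.sum_congr rfl fun z _ => by rw [Finset.mul_sum]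

/-- kernel: exchanging the order of summation (double middle sum). [cite: Balaban1983Higgs3, (3.23) p.439] -/
private theorem swap_double {ι : Type*} [Fintype ι] (w : ℝ) (f G : ι → ℝ) (E K : ι → ι → ℝ) :
    ∑ y', w * ((w * ∑ z, ∑ z', f z * E z z' * K z' y') * G y') =
      ∑ z, ∑ z', w * f z * E z z' * ∑ y', w * (K z' y' * G y') := by
  calc ∑ y', w * ((w * ∑ z, ∑ z', f z * E z z' * K z' y') * G y')
      = ∑ y', ∑ z, ∑ z', w * f z * E z z' * (w * (K z' y' * G y')) := by
        refine Finset.sum_congr rfl fun y' _ => ?_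
        rw [Finset.mul_sum, Finset.sum_mul, Finset.mul_sum]
        refine Finset.sum_congr rfl fun z _ => ?_
        rw [Finset.mul_sum, Finset.sum_mul, Finset.mul_sum]
        exact Finset.sum_congr rfl fun z' _ => by ring
    _ = ∑ z, ∑ y', ∑ z', w * f z * E z z' * (w * (K z' y' * G y')) := Finset.sum_comm
    _ = ∑ z, ∑ z', ∑ y', w * f z * E z z' * (w * (K z' y' * G y')) :=
        Finset.sum_congr rfl fun z _ => Finset.sum_comm
    _ = ∑ z, ∑ z', w * f z * E z z' * ∑ y', w * (K z' y' * G y') :=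
        Finset.sum_congr rfl fun z _ => Finset.sum_congr rfl fun z' _ => by rw [Finset.mul_sum]

/-- kernel: the cross term `Σξ^d(∂M)G(0)` after exchanging the order of summation — `ℓ¹` of the differentiated factor times the
sup of `C∘G(0)`, with `Σ_{z′}|P_k(z,z′)| ≤ 1`. [cite: Balaban1983Higgs3, (3.23) p.439] -/
private theorem abs_cross_le {ι : Type*} [Fintype ι] {w F S c₁ c₂ b₁ b₂ : ℝ} (hw : 0 ≤ w) (hS : 0 ≤ S)
    (f G : ι → ℝ) (E K : ι → ι → ℝ)
    (hf : ∑ z, w * |f z| ≤ F) (hK : ∀ z, |∑ y', w * (K z y' * G y')| ≤ S) (hE : ∀ z, ∑ z', |E z z'| ≤ 1)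
    (h1 : |c₁| ≤ b₁) (h2 : |c₂| ≤ b₂) :
    |∑ y', w * ((w * (c₁ * ∑ z, f z * K z y' - c₂ * ∑ z, ∑ z', f z * E z z' * K z' y')) * G y')| ≤
      (b₁ + b₂) * (F * S) := by
  have hsplit : ∑ y', w * ((w * (c₁ * ∑ z, f z * K z y' - c₂ * ∑ z, ∑ z', f z * E z z' * K z' y')) * G y') =
      c₁ * ∑ y', w * ((w * ∑ z, f z * K z y') * G y') -
        c₂ * ∑ y', w * ((w * ∑ z, ∑ z', f z * E z z' * K z' y') * G y') := by
    rw [Finset.mul_sum, Finset.mul_sum, ← Finset.sum_sub_distrib]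
    exact Finset.sum_congr rfl fun y' _ => by ring
  rw [hsplit, swap_single, swap_double]
  have hT1 : |∑ z, w * f z * ∑ y', w * (K z y' * G y')| ≤ F * S := by
    calc |∑ z, w * f z * ∑ y', w * (K z y' * G y')| ≤ ∑ z, |w * f z * ∑ y', w * (K z y' * G y')| :=
          Finset.abs_sum_le_sum_abs _ _
      _ ≤ ∑ z, w * |f z| * S := Finset.sum_le_sum fun z _ => by
          rw [abs_mul, abs_mul, abs_of_nonneg hw]
          exact mul_le_mul_of_nonneg_left (hK z) (mul_nonneg hw (abs_nonneg _))
      _ = (∑ z, w * |f z|) * S := by rw [Finset.sum_mul]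
      _ ≤ F * S := mul_le_mul_of_nonneg_right hf hS
  have hT2 : |∑ z, ∑ z', w * f z * E z z' * ∑ y', w * (K z' y' * G y')| ≤ F * S := by
    calc |∑ z, ∑ z', w * f z * E z z' * ∑ y', w * (K z' y' * G y')|
        ≤ ∑ z, |∑ z', w * f z * E z z' * ∑ y', w * (K z' y' * G y')| := Finset.abs_sum_le_sum_abs _ _
      _ ≤ ∑ z, ∑ z', |w * f z * E z z' * ∑ y', w * (K z' y' * G y')| :=
          Finset.sum_le_sum fun z _ => Finset.abs_sum_le_sum_abs _ _
      _ ≤ ∑ z, ∑ z', w * |f z| * |E z z'| * S :=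
          Finset.sum_le_sum fun z _ => Finset.sum_le_sum fun z' _ => by
            rw [abs_mul, abs_mul, abs_mul, abs_of_nonneg hw]
            exact mul_le_mul_of_nonneg_left (hK z') (by positivity)
      _ = ∑ z, w * |f z| * S * ∑ z', |E z z'| := by
          refine Finset.sum_congr rfl fun z _ => ?_
          rw [Finset.mul_sum]
          exact Finset.sum_congr rfl fun z' _ => by ring
      _ ≤ ∑ z, w * |f z| * S * 1 :=
          Finset.sum_le_sum fun z _ => mul_le_mul_of_nonneg_left (hE z) (by positivity)
      _ = (∑ z, w * |f z|) * S := by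
          rw [Finset.sum_mul]
          exact Finset.sum_congr rfl fun z _ => by ring
      _ ≤ F * S := mul_le_mul_of_nonneg_right hf hS
  have hb₁ : 0 ≤ b₁ := (abs_nonneg _).trans h1
  have hb₂ : 0 ≤ b₂ := (abs_nonneg _).trans h2
  calc |c₁ * ∑ z, w * f z * ∑ y', w * (K z y' * G y') -
        c₂ * ∑ z, ∑ z', w * f z * E z z' * ∑ y', w * (K z' y' * G y')|
      ≤ |c₁ * ∑ z, w * f z * ∑ y', w * (K z y' * G y')| +
          |c₂ * ∑ z, ∑ z', w * f z * E z z' * ∑ y', w * (K z' y' * G y')| := abs_sub _ _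
    _ ≤ b₁ * (F * S) + b₂ * (F * S) := by
        rw [abs_mul, abs_mul]
        exact add_le_add (mul_le_mul h1 hT1 (abs_nonneg _) hb₁) (mul_le_mul h2 hT2 (abs_nonneg _) hb₂)
    _ = (b₁ + b₂) * (F * S) := by ring

/-- **p. 439 [PDF 29], the FIRST TERM of (3.23) is "convergent" (bounded by one constant) AT THE ZERO-FIELD TORUS INSTANCE, all
cross terms included.**  For odd `L > 1`, `a > 0`, `m² ≥ 0` there is ONE constant `C₁` such that for every volume `P = (3, L, m, K)`
of Bałaban's scalar torus tower, every scale `1 ≤ k ≤ K` (`ξ = L^{−k}`, `j″ = k`), with `G^ξ_{j″}(0) = G^ξ_{j″} := G0xi P a msq k`,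
every direction `μ` and every `y`:  `|Σ_{y′}ξ^d(∂^ξ_μG^ξ_{j″}(0))(y,y′)G^ξ_{j″}(y,y′)| ≤ C₁`.  (The print: the replacement
`G^ξ_{j″}(0) = C^ξ + G^ξ_{j″}(0)(1 − m² − aP)C^ξ` gives *"some convergent expressions plus q²gg′Σ_{x′}ξ^d(∂^ξ_μC^ξ)C^ξ"*; here the
`C^ξ_TC^ξ_T` sum is gen 5's `abs_first324_CxiT_le`, `Σξ^d(∂C)M` is `‖∂C^ξ_T‖₁·sup|M|`, and `Σξ^d(∂M)G(0)` is
`(|1 − (L^kε)²m²| + a_k)·‖∂G(0)‖₁·sup|C^ξ_T∘G(0)|`.) [cite: Balaban1983Higgs3, (3.23) p.439] -/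
theorem first323_G0xi_zero_torus (L : ℕ) (hL : Odd L ∧ 1 < L) {a : ℝ} (ha : 0 < a) {msq : ℝ} (hmsq : 0 ≤ msq) :
    ∃ C₁ : ℝ, 0 < C₁ ∧ ∀ (P : Params), P.d = 3 → P.L = L → ∀ k : ℕ, 1 ≤ k → k ≤ P.K →
      ∀ (μ : Fin P.d) (y : Site P 0),
        |∑ y' : Site P 0, P.eta k ^ P.d *
            (d1Kernel (P.eta k)⁻¹ μ (G0xi P a msq k) y y' * G0xi P a msq k y y')| ≤ C₁ := by
  obtain ⟨δ, C, hδ, hC, HG⟩ := G0xi_bounds L hL ha hmsq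
  have hT := torusConst_nonneg
  have hq : (0 : ℝ) < 1 / 2 / 2 := by norm_num
  have hR₀ := radialConst_nonneg 3 hδ zero_le_one 0
  have hR₁ := radialConst_nonneg 3 (half_pos hδ) zero_le_one 0
  have hR₂ := radialConst_nonneg 3 hq zero_le_one 0
  have hR₃ := radialConst_nonneg 3 (half_pos hδ) zero_le_one 2
  have hR₄ := radialConst_nonneg 3 hq zero_le_one 2
  have hR₅ := radialConst_nonneg 3 one_half_pos zero_le_one 0
  -- the constants (functions of `L, a, m²` through `δ, C` only)
  set F₀ : ℝ := ((torusConst + 472501) ^ 2 + 108 * 3037500 ^ 2) / 2 with hF₀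
  set Msup : ℝ := (1 + msq) * (C * (torusConst + 472501) / 2 *
      (2 + radialConst 3 (δ / 2) 1 0 + radialConst 3 (1 / 2 / 2) 1 0)) +
    a * (C * (torusConst + 472501) / 2 *
      ((1 + radialConst 3 (δ / 2) 1 0) * (1 + radialConst 3 (1 / 2 / 2) 1 2) +
        (1 + radialConst 3 (δ / 2) 1 2) * (1 + radialConst 3 (1 / 2 / 2) 1 0))) with hMsup
  set Ssup : ℝ := (torusConst + 472501) * C / 2 *
      (2 + radialConst 3 (1 / 2 / 2) 1 0 + radialConst 3 (δ / 2) 1 0) with hSsup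
  set FG : ℝ := C * (1 + radialConst 3 δ 1 0) with hFG
  set FC : ℝ := (3037500 + torusConst + 472501) * (1 + radialConst 3 (1 / 2) 1 0) with hFC
  have hMsup0 : 0 ≤ Msup := by rw [hMsup]; positivity
  have hSsup0 : 0 ≤ Ssup := by rw [hSsup]; positivity
  have hF₀0 : 0 ≤ F₀ := by rw [hF₀]; positivity
  have hFG0 : 0 ≤ FG := by rw [hFG]; positivity
  have hFC0 : 0 ≤ FC := by rw [hFC]; positivity
  refine ⟨F₀ + FC * Msup + (1 + msq + a) * (FG * Ssup) + 1, by positivity, fun P hPd hPL k hk1 hkK μ y => ?_⟩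
  obtain ⟨hGv, hGd⟩ := HG P hPd hPL k hk1 hkK
  have hkm : k ≤ P.m + P.K := hkK.trans (Nat.le_add_left _ _)
  have hη : 0 < P.eta k := eta_pos P k
  have hη1 : P.eta k ≤ 1 := eta_le_one P k
  have hηd : 0 < P.eta k ^ P.d := pow_pos hη _
  have hN : 1 ≤ P.eta k * (P.sitesPerDir 0 : ℝ) := one_le_eta_mul_sitesPerDir P hkm
  have hs1 : P.spacing k ≤ 1 := spacing_le_one P hkK
  have hs0 : 0 < P.spacing k := P.spacing_pos k
  have hL1 : (1 : ℝ) < (P.L : ℝ) := one_lt_cast_L P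
  -- (a) the printed `C^ξC^ξ` term, bounded by (3.24) on the torus
  have h0 : |∑ y' : Site P 0, P.eta k ^ P.d *
      (d1Kernel (P.eta k)⁻¹ μ (CxiT (P.eta k)) y y' * CxiT (P.eta k) y y')| ≤ F₀ := by
    rw [hF₀]; exact abs_first324_CxiT_le hPd hη hη1 hN μ y
  -- (b) `Σξ^d(∂C)M`: sup|M| times the ℓ¹ norm of ∂C
  have hM : ∀ y' : Site P 0, |Mxi P a msq k y y'| ≤ Msup := fun y' => by
    rw [hMsup]; exact abs_Mxi_le hPd ha hmsq hk1 hkK hδ hC.le hGv y y'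
  have hfC : ∑ y' : Site P 0, P.eta k ^ P.d * |d1Kernel (P.eta k)⁻¹ μ (CxiT (P.eta k)) y y'| ≤ FC := by
    rw [hFC]
    exact sum_abs_le_of_profile hPd hη hη1 one_half_pos (by linarith) (d1Kernel (P.eta k)⁻¹ μ (CxiT (P.eta k))) y
      fun z => abs_d1Kernel_CxiT_profile hPd hη hη1 hN μ y z
  have hX1 : |∑ y' : Site P 0, P.eta k ^ P.d *
      (d1Kernel (P.eta k)⁻¹ μ (CxiT (P.eta k)) y y' * Mxi P a msq k y y')| ≤ FC * Msup :=
    abs_sum_mul_le hηd.le hMsup0 (fun y' => d1Kernel (P.eta k)⁻¹ μ (CxiT (P.eta k)) y y')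
      (fun y' => Mxi P a msq k y y') hfC hM
  -- (c) `Σξ^d(∂M)G(0)`: exchange the order of summation
  have hS : ∀ z : Site P 0, |∑ y' : Site P 0, P.eta k ^ P.d * (CxiT (P.eta k) z y' * G0xi P a msq k y y')| ≤ Ssup :=
    fun z => by rw [hSsup]; exact abs_sum_CxiT_mul_G0xi_le hPd hkK hδ hC.le hGv z y
  have hfG : ∑ z : Site P 0, P.eta k ^ P.d * |d1Kernel (P.eta k)⁻¹ μ (G0xi P a msq k) y z| ≤ FG := by
    rw [hFG]
    exact sum_abs_le_of_profile hPd hη hη1 hδ hC.le (d1Kernel (P.eta k)⁻¹ μ (G0xi P a msq k)) y fun z => hGd μ y z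
  have hPk : ∀ z : Site P 0, ∑ z' : Site P 0, |(Qks P k * Qk P k) z z'| ≤ 1 := fun z => (sum_abs_Pk_row hkm z).le
  have hc₁ : |1 - P.spacing k ^ 2 * msq| ≤ 1 + msq := by
    have hs2 : P.spacing k ^ 2 ≤ 1 := pow_le_one₀ hs0.le hs1
    have hsm : P.spacing k ^ 2 * msq ≤ msq := mul_le_of_le_one_left hmsq hs2
    have hsm0 : 0 ≤ P.spacing k ^ 2 * msq := mul_nonneg (pow_nonneg hs0.le 2) hmsq
    rw [abs_le]; constructor <;> linarith
  have hc₂ : |B1.aSeq a P.L k| ≤ a := by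
    rw [abs_of_nonneg (B1.aSeq_pos ha hL1 hk1).le]; exact B1.aSeq_le ha hL1 k hk1
  have hX23 : |∑ y' : Site P 0, P.eta k ^ P.d *
      (d1Kernel (P.eta k)⁻¹ μ (Mxi P a msq k) y y' * G0xi P a msq k y y')| ≤ (1 + msq + a) * (FG * Ssup) := by
    simp_rw [d1Kernel_Mxi_split ha hmsq hk1 μ y]
    exact abs_cross_le hηd.le hSsup0 (fun z => d1Kernel (P.eta k)⁻¹ μ (G0xi P a msq k) y z)
      (fun y' => G0xi P a msq k y y') (fun z z' => (Qks P k * Qk P k) z z') (CxiT (P.eta k)) hfG hS hPk hc₁ hc₂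
  -- assembly
  have htot : |∑ y' : Site P 0, P.eta k ^ P.d *
      (d1Kernel (P.eta k)⁻¹ μ (G0xi P a msq k) y y' * G0xi P a msq k y y')| ≤
      F₀ + FC * Msup + (1 + msq + a) * (FG * Ssup) := by
    rw [first323_G0xi_split]
    exact (abs_add_three _ _ _).trans (add_le_add (add_le_add h0 hX1) hX23)
  linarith

/-- **p. 439 [PDF 29]: "Hence the last graph in (3.22) defines a vertex with some convergent function" — AT THE ZERO-FIELD TORUS
INSTANCE WITH NO KERNEL HYPOTHESIS LEFT.**  For odd `L > 1`, `a > 0`, `m² ≥ 0` there are constants `C₁, C₂` such that for every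
volume `P = (3, L, m, K)`, every scale `1 ≤ k ≤ K` (`ξ = L^{−k}`), with both resummed propagators `G^ξ_{j″}(0) = G^ξ_{j″} := G0xi P a msq k`,
every direction `μ`, all localizations `|g|, |g′| ≤ 1` with `g′` Lipschitz, `|g′(y′) − g′(y)| ≤ K′ξ|y − y′|₁` (the reading of the
printed insertion `(g′(x′) − g′(x))/|x′ − x|·|x′ − x|`), and every `y`, r15's bracket of (3.23) satisfies
`|[(3.23)](y)| ≤ C₁ + C₂K′` (first term: `first323_G0xi_zero_torus`; second term: gen 5 `B3Bound323.abs_bracket323_le_first_add` with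
`hM`, `hG` := `G0xi_bounds_offdiag`, `radialConst` at `ξ = 1`). [cite: Balaban1983Higgs3, (3.23) p.439] -/
theorem bracket323_G0xi_zero_torus (L : ℕ) (hL : Odd L ∧ 1 < L) {a : ℝ} (ha : 0 < a) {msq : ℝ} (hmsq : 0 ≤ msq) :
    ∃ C₁ C₂ : ℝ, 0 < C₁ ∧ 0 < C₂ ∧ ∀ (P : Params), P.d = 3 → P.L = L → ∀ k : ℕ, 1 ≤ k → k ≤ P.K →
      ∀ (K : ℝ), 0 ≤ K → ∀ (g g' : SiteField P 0 ℝ) (μ : Fin P.d), (∀ y, |g y| ≤ 1) → (∀ y, |g' y| ≤ 1) →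
        (∀ y y' : Site P 0, |g' y' - g' y| ≤ K * (P.eta k * Site.tdist y y')) →
        ∀ y : Site P 0, |bracket323 (P.eta k) μ (G0xi P a msq k) (G0xi P a msq k) g g' y| ≤ C₁ + C₂ * K := by
  obtain ⟨C₁, hC₁, H1⟩ := first323_G0xi_zero_torus L hL ha hmsq
  obtain ⟨δ, C, hδ, hC, HG⟩ := G0xi_bounds_offdiag L hL ha hmsq
  have hR := radialConst_nonneg 3 hδ zero_le_one 0
  refine ⟨C₁, 3 * C * C * radialConst 3 δ 1 0 + 1, hC₁, by positivity,
    fun P hPd hPL k hk1 hkK K hK g g' μ hg hg'1 hg' y => ?_⟩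
  obtain ⟨hGv, hGd⟩ := HG P hPd hPL k hk1 hkK
  have hη : 0 < P.eta k := eta_pos P k
  have hη1 : P.eta k ≤ 1 := eta_le_one P k
  have h := abs_bracket323_le_first_add hPd hη hδ hC.le hC.le hK (G0xi P a msq k) (G0xi P a msq k) g g' μ
    (fun y y' hne => hGd μ y y' hne) (fun y y' hne => hGv y y' hne) hg hg' y
  have h1 := H1 P hPd hPL k hk1 hkK μ y
  have h2 : |g y * g' y * ∑ y' : Site P 0, P.eta k ^ P.d *
      (d1Kernel (P.eta k)⁻¹ μ (G0xi P a msq k) y y' * G0xi P a msq k y y')| ≤ C₁ := by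
    rw [abs_mul, abs_mul]
    have hgg : |g y| * |g' y| ≤ 1 :=
      calc |g y| * |g' y| ≤ 1 * 1 := mul_le_mul (hg y) (hg'1 y) (abs_nonneg _) zero_le_one
        _ = 1 := mul_one 1
    have h0 : 0 ≤ |∑ y' : Site P 0, P.eta k ^ P.d *
        (d1Kernel (P.eta k)⁻¹ μ (G0xi P a msq k) y y' * G0xi P a msq k y y')| := abs_nonneg _
    nlinarith
  have h3 : (P.d : ℝ) * C * C * K * radialConst P.d δ (P.eta k) 0 ≤ (3 * C * C * radialConst 3 δ 1 0 + 1) * K := by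
    rw [hPd]
    push_cast
    have hm := radialConst_mono 3 hδ hη1 0
    have h4 : 3 * C * C * K * radialConst 3 δ (P.eta k) 0 ≤ 3 * C * C * K * radialConst 3 δ 1 0 :=
      mul_le_mul_of_nonneg_left hm (by positivity)
    nlinarith
  linarith

/-- **(3.23) "defines a vertex with some convergent function" AT THE EXPRESSION LEVEL (v1.1 rider)**: with the bracket bounded by
`C₁ + C₂K′` (`bracket323_G0xi_zero_torus`), r15's whole expression (3.23) `expr323` — `Σ_μΣ_xξ^dφ(x)·[(3.23)](x)·q²(∂^ξ_μφ′)(x)` with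
both resummed propagators the zero-field torus instance `G0xi` — is a vertex with a BOUNDED coefficient:
`|(3.23)| ≤ (C₁ + C₂K′)·Σ_μΣ_x ξ³‖φ(x)‖‖q²(∂^ξ_μφ′)(x)‖`, one pair of constants for all volumes `P = (3,L,m,K)`, all scales
`1 ≤ k ≤ K`, all `|g|, |g′| ≤ 1` with `g′` `K′`-Lipschitz, every coupling map `q` and all fields `φ, φ′`.
[cite: Balaban1983Higgs3, (3.23) p.439] -/
theorem expr323_G0xi_zero_torus (L : ℕ) (hL : Odd L ∧ 1 < L) {a : ℝ} (ha : 0 < a) {msq : ℝ} (hmsq : 0 ≤ msq) :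
    ∃ C₁ C₂ : ℝ, 0 < C₁ ∧ 0 < C₂ ∧ ∀ (P : Params), P.d = 3 → P.L = L → ∀ k : ℕ, 1 ≤ k → k ≤ P.K →
      ∀ {W : Type*} [NormedAddCommGroup W] [InnerProductSpace ℝ W] (q : W →ₗ[ℝ] W) (K : ℝ), 0 ≤ K →
        ∀ (g g' : SiteField P 0 ℝ) (φ φ' : SiteField P 0 W), (∀ y, |g y| ≤ 1) → (∀ y, |g' y| ≤ 1) →
        (∀ y y' : Site P 0, |g' y' - g' y| ≤ K * (P.eta k * Site.tdist y y')) →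
        |expr323 (P.eta k) q (G0xi P a msq k) (G0xi P a msq k) g g' φ φ'| ≤
          (C₁ + C₂ * K) * ∑ μ : Fin P.d, ∑ y : Site P 0,
            P.eta k ^ P.d * (‖φ y‖ * ‖q (q (pdiff (P.eta k)⁻¹ μ φ' y))‖) := by
  obtain ⟨C₁, C₂, hC₁, hC₂, H⟩ := bracket323_G0xi_zero_torus L hL ha hmsq
  refine ⟨C₁, C₂, hC₁, hC₂, fun P hPd hPL k hk1 hkK W _ _ q K hK g g' φ φ' hg hg'1 hg' => ?_⟩
  have hη : 0 < P.eta k := eta_pos P k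
  have hηd : 0 ≤ P.eta k ^ P.d := pow_nonneg hη.le _
  have hCK : 0 ≤ C₁ + C₂ * K := by positivity
  unfold expr323
  rw [Finset.mul_sum]
  refine (Finset.abs_sum_le_sum_abs _ _).trans (Finset.sum_le_sum fun μ _ => ?_)
  rw [Finset.mul_sum]
  refine (Finset.abs_sum_le_sum_abs _ _).trans (Finset.sum_le_sum fun y _ => ?_)
  rw [abs_mul, abs_of_nonneg hηd, abs_mul]
  have h1 := H P hPd hPL k hk1 hkK K hK g g' μ hg hg'1 hg' y
  have h2 : |inner ℝ (φ y) (q (q (pdiff (P.eta k)⁻¹ μ φ' y)))| ≤ ‖φ y‖ * ‖q (q (pdiff (P.eta k)⁻¹ μ φ' y))‖ :=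
    abs_real_inner_le_norm _ _
  calc P.eta k ^ P.d * (|bracket323 (P.eta k) μ (G0xi P a msq k) (G0xi P a msq k) g g' y| *
          |inner ℝ (φ y) (q (q (pdiff (P.eta k)⁻¹ μ φ' y)))|)
      ≤ P.eta k ^ P.d * ((C₁ + C₂ * K) * (‖φ y‖ * ‖q (q (pdiff (P.eta k)⁻¹ μ φ' y))‖)) :=
        mul_le_mul_of_nonneg_left (mul_le_mul h1 h2 (abs_nonneg _) hCK) hηd
    _ = (C₁ + C₂ * K) * (P.eta k ^ P.d * (‖φ y‖ * ‖q (q (pdiff (P.eta k)⁻¹ μ φ' y))‖)) := by ring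

end

end Literature.MathematicalPhysics.QuantumFieldTheory.Balaban1983to89.B3Eq323CrossTermsZeroTorus
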